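import Literature.Probability.Percolation.CardyFormula
import Literature.Probability.Percolation.QuadCrossingRotationInvariance
import Literature.Probability.LatticeModels.IsoradialPercolationProofs
import HarnessLib

/-!
# DKKMO, Theorem 2.1 at `q = 1`: universality of quad-crossing probabilities among the isoradial
# rectangular lattices `𝕃(α)` (light imports: `CardyFormula` / `QuadCrossingRotationInvariance`)

Topic `Probability/Percolation`; namespace `Literature.Probability.Percolation`. Sibling of
`QuadCrossingRotationInvariance` (the Schramm–Smirnov crossing event `quadCrossing R δ` of a quad
`Q = (closure R.carrier; R.pt 0, …, R.pt 3)` by the open edges of `δℤ²` drawn in the plane, and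
the named fact `dkkmo_crossing_rotation_invariance` = DKKMO Corollary 1.3 at `q = 1`). This file
imports only `CardyFormula`, `QuadCrossingRotationInvariance` and the light proof file
`LatticeModels.IsoradialPercolationProofs` — no loop representation, no FK-Ising fermionic
observable (`IsoradialRectangularLoops`, `LoopRotationInvariance`, `LoopRepresentation` are NOT
imported), as requested for route `CardyRetileGlue` of `CardyFormulaZ2`.

H. Duminil-Copin, K. K. Kozlowski, D. Krachun, I. Manolescu, M. Oulamara, *Rotational invariance
in critical planar lattice models*, arXiv:2012.11672v1 (held copy `paper:arxiv-2012.11672`, read):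

* §2.1, p. 7: the isoradial rectangular lattices `𝕃(α)`, `α ∈ (0, π)` — isoradial embeddings of
  the square lattice with horizontal tracks of constant transverse angle `α`; faces are rectangles
  inscribed in circles of radius `1` (sides `2 cos(α/2)`, `2 sin(α/2)`); "`𝕃(α)` is a rotated
  version of a rectangular lattice that has `e^{iα/2}ℝ` as axis of symmetry. In particular,
  `𝕃(π/2)` is simply a rescaled and rotated (by an angle of `π/4`) version of `ℤ²`."
* §2.2, p. 7: "isoradial graphs `𝕃(α)` are associated to a canonical set of edge-weights, therefore
  producing random-cluster measures `φ_{δ𝕃(α)}` on `δ𝕃(α)`" (infinite volume); at `q = 1` these are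
  the product Bernoulli measures with Grimmett–Manolescu's isoradial critical probabilities `p_θ`
  (`criticalWeightI θ`), `θ = α/2` on the edges of length `2 cos(α/2)`, `θ = (π-α)/2` on those of
  length `2 sin(α/2)`.
* **Theorem 2.1** (p. 7). "For `q ∈ [1,4]` and `ε > 0`, there exists `δ₀ = δ₀(q, ε) > 0` such that
  for every `δ < δ₀` and `α ∈ (ε, π - ε)`, there exists a coupling `P_{α,δ,ε}` between
  `ω ∼ φ_{δ𝕃(α)}` and `ω' ∼ φ_{δ𝕃(π/2)}` such that `P_{α,δ,ε}[d_CN(ω, ω') > ε] < ε`,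
  `P_{α,δ,ε}[d_SS(ω, ω') > ε] < ε`. This result states the universality of the scaling limit among
  rectangular lattices."
* Reading a `d_SS`-coupling on crossing probabilities: §1.3, p. 5, "the definition of the
  Schramm–Smirnov topology implies, in particular, that crossing probabilities are invariant …
  For a quad `Q`, let `{ω ∈ 𝒞(Q)}` be the event that `Q` is crossed", printed for Theorem 1.2 as
  Corollary 1.3 with the proof (§7.1, p. 43) "the result follows directly from Theorem 1.2 and the
  measurability of `𝒞(Q)` in the Schramm–Smirnov topology". The same sentence applied to
  Theorem 2.1 is what is vendored below — for each quad, as for `dkkmo_crossing_rotation_invariance`.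

## What is formalised

* `isoRectEmbedding α` — the rectangular lattice with faces `2 cos(α/2) × 2 sin(α/2)` in
  axis-parallel position (`x ↦ 2cos(α/2) x₀ + 2 sin(α/2) x₁ i`); `isoRectEmbedding (π/2) =
  squareLatticeEmbedding.z` (`√2 ℤ²`, proved); `isoRectDrawing α x = e^{iα/2} · isoRectEmbedding α x`
  — DKKMO's position of `𝕃(α)` (axis of symmetry `e^{iα/2}ℝ`; the `isoRectLinear α` of
  `IsoradialRectangularLoops`, not imported), so that `isoRectDrawing (π/2) = e^{iπ/4} √2 ℤ²` is
  "`ℤ²` rescaled and rotated by `π/4`" (`isoRectDrawing_pi_div_two`).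
* `isoRectCriticalProb α` — the `q = 1` canonical weights on the edges of the abstract `ℤ²`
  (`criticalWeightI (α/2)` on horizontal edges `x₁ = y₁`, `criticalWeightI ((π-α)/2)` on the others,
  `0` off the edge set; extensionally the `isoRectWeight α` of `IsoradialRectangularLoops`, with
  `IsHorizontal e` spelled `∃ x y, e = s(x, y) ∧ x 1 = y 1`); all weights are `1/2` at `α = π/2`
  (`isoRectCriticalProb_pi_div_two`).
* `openEdgeUnionEmb z δ ω`, `quadCrossingEmb z R δ` — the Schramm–Smirnov crossing event of the
  quad `R` by the open edges of the abstract `ℤ²` DRAWN ALONG AN EMBEDDING `z : ℤ² → ℂ` at mesh `δ`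
  (segments `[δ z x, δ z y]`); for `z = Site.toComplex` these are literally the sibling's
  `openEdgeUnion`, `quadCrossing` (`openEdgeUnionEmb_toComplex`, `quadCrossingEmb_toComplex`).
* `DKKMO2020_thm21_quadCrossingProb` — **the named fact**: Theorem 2.1 at `q = 1` read on the
  crossing probability of each quad: for every conformal rectangle `R` and `ε > 0` there is `δ₀ > 0`
  such that for all `α ∈ (ε, π - ε)` and `δ ∈ (0, δ₀)`,
  `|P_{𝕃(α)}[𝒞_δ(Q) on δ𝕃(α)] - P_{𝕃(π/2)}[𝒞_δ(Q) on δ𝕃(π/2)]| ≤ ε`, both measures rendered the same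
  way (`prodBernoulli (isoRectCriticalProb ·)`), both lattices in DKKMO's positions
  (`isoRectDrawing α`, `isoRectDrawing (π/2)`).

NOT vendored (arguments, not citations — left to the route, see also the sibling's docstring):
the passage from `𝒞_δ(Q)` to the discrete-arc events `embDomainCrossing` / `discreteCrossing`
(boundary effects; RSW-type continuity in the quad, uniform in the mesh), arbitrary rotations and
mesh-dependent offsets of the lattices (compose with `dkkmo_crossing_rotation_invariance` and the
lattice symmetries), the identification `prodBernoulli (isoRectCriticalProb (π/2)) = bondPercolation
(zdGraph 2) half` (`prodBernoulli_indicator`), and the coupling form with agreeing crossing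
indicators (the `d_SS` statement itself plus quad continuity in `𝔥`).

## References

* [DKKMO2020Rotational] arXiv:2012.11672v1: §2.1–2.2 p. 7 (`𝕃(α)`, weights, Thm. 2.1), §1.3
  p. 5 and §7.1 p. 43 (crossing probabilities from `d_SS`).
* [GrimmettManolescu2014] G. R. Grimmett, I. Manolescu, PTRF 159 (2014), (1.3)/(2.1) (`p_θ`).
-/

noncomputable section

open MeasureTheory Filter Topology Set
open scoped Classical

namespace Literature.Probability.Percolation

open LatticeModels RandomPlanarGeometry

/-! ### The rectangular lattices `𝕃(α)` and their canonical weights at `q = 1` -/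

/-- **The isoradial rectangular lattice `𝕃(α)`, axis-parallel position**: the vertex `x ∈ ℤ²`
sits at `2 cos(α/2) x₀ + 2 sin(α/2) x₁ i`, so that the faces are rectangles of sides `2 cos(α/2)`,
`2 sin(α/2)` inscribed in circles of radius `1` (DKKMO's normalisation: isoradial with unit radius).
[cite: DKKMO2020Rotational, §2.1 p. 7 (rectangular lattices 𝕃(α))] -/
def isoRectEmbedding (α : ℝ) (x : Site 2) : ℂ :=
  (2 * Real.cos (α / 2) : ℝ) * ((x 0 : ℤ) : ℂ) + (2 * Real.sin (α / 2) : ℝ) * ((x 1 : ℤ) : ℂ) * Complex.I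

/-- `𝕃(π/2)` in axis-parallel position is the tree's `√2 ℤ²` (`squareLatticeEmbedding`):
`2 cos(π/4) = 2 sin(π/4) = √2`. [folklore] -/
theorem isoRectEmbedding_pi_div_two (x : Site 2) :
    isoRectEmbedding (Real.pi / 2) x = squareLatticeEmbedding.z x := by
  have h4 : Real.pi / 2 / 2 = Real.pi / 4 := by ring
  have hs : 2 * (Real.sqrt 2 / 2) = Real.sqrt 2 := by ring
  simp only [isoRectEmbedding, h4, Real.cos_pi_div_four, Real.sin_pi_div_four, hs,
    squareLatticeEmbedding, Site.toComplex, Complex.mk_eq_add_mul_I]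
  push_cast
  ring

/-- **DKKMO's position of `𝕃(α)`**: the axis-parallel rectangular lattice rotated by `e^{iα/2}`, so
that "`𝕃(α)` … has `e^{iα/2}ℝ` as axis of symmetry" and "`𝕃(π/2)` is simply a rescaled and rotated
(by an angle of `π/4`) version of `ℤ²`" (the `isoRectLinear α` of `IsoradialRectangularLoops` on
lattice points). [cite: DKKMO2020Rotational, §2.1 p. 7] -/
def isoRectDrawing (α : ℝ) (x : Site 2) : ℂ :=
  Complex.exp (((α / 2 : ℝ) : ℂ) * Complex.I) * isoRectEmbedding α x

/-- `𝕃(π/2)` in DKKMO's position is `e^{iπ/4} √2 ℤ²`, i.e. `squareLatticeEmbedding` rotated by `π/4`.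
[cite: DKKMO2020Rotational, §2.1 p. 7] -/
theorem isoRectDrawing_pi_div_two (x : Site 2) :
    isoRectDrawing (Real.pi / 2) x =
      Complex.exp (((Real.pi / 4 : ℝ) : ℂ) * Complex.I) * squareLatticeEmbedding.z x := by
  rw [isoRectDrawing, isoRectEmbedding_pi_div_two, show Real.pi / 2 / 2 = Real.pi / 4 by ring]

/-- **The canonical (`q = 1`) isoradial weights of `𝕃(α)`** on the edges of the abstract `ℤ²`:
a horizontal edge (`x₁ = y₁`, length `2 cos(α/2)`, half-angle `α/2`) is open with probability
`p_{α/2} = criticalWeightI (α/2)`, a vertical edge (half-angle `(π - α)/2`) with probability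
`criticalWeightI ((π - α)/2)`, and non-edges never (Grimmett–Manolescu's `p_θ`; DKKMO §2.2: "isoradial
graphs `𝕃(α)` are associated to a canonical set of edge-weights"). Extensionally the
`isoRectWeight α` of `IsoradialRectangularLoops` (not imported here; `IsHorizontal` spelled out).
[cite: DKKMO2020Rotational, §2.2 p. 7] [cite: GrimmettManolescu2014, (1.3)/(2.1)] -/
def isoRectCriticalProb (α : ℝ) (e : Sym2 (Site 2)) : unitInterval :=
  if e ∈ (zdGraph 2).edgeSet then
    (if (∃ x y : Site 2, e = s(x, y) ∧ x 1 = y 1) then criticalWeightI (α / 2)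
      else criticalWeightI ((Real.pi - α) / 2))
  else 0

/-- At `α = π/2` all weights are `1/2` on the edges of `ℤ²` (and `0` off them): `φ_{𝕃(π/2)}` at
`q = 1` is critical bond percolation on `ℤ²`. [cite: DKKMO2020Rotational, §2.1 p. 7] -/
theorem isoRectCriticalProb_pi_div_two :
    isoRectCriticalProb (Real.pi / 2) = fun e => if e ∈ (zdGraph 2).edgeSet then half else 0 := by
  funext e
  have h1 : Real.pi / 2 / 2 = Real.pi / 4 := by ring
  have h2 : (Real.pi - Real.pi / 2) / 2 = Real.pi / 4 := by ring
  simp only [isoRectCriticalProb, h1, h2, criticalWeightI_pi_div_four, ite_self]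

/-! ### The Schramm–Smirnov crossing event for a drawn lattice -/

/-- The open edges of the bond configuration `ω` on the abstract `ℤ²`, DRAWN ALONG THE EMBEDDING
`z : ℤ² → ℂ` at mesh `δ`: the union over the open lattice edges `{x, y} ∈ ω` of the closed segments
`[δ z x, δ z y]` (the sibling's `openEdgeUnion` is the case `z = Site.toComplex`, `δℤ²`).
[cite: DKKMO2020Rotational, §1.2 p. 4 (open paths as continuous paths in the plane)] -/
def openEdgeUnionEmb (z : Site 2 → ℂ) (δ : ℝ) (ω : BondConfig (Site 2)) : Set ℂ :=
  ⋃ (x : Site 2) (y : Site 2) (_ : (zdGraph 2).Adj x y) (_ : s(x, y) ∈ ω),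
    segment ℝ ((δ : ℂ) * z x) ((δ : ℂ) * z y)

/-- For the unit square lattice `z = Site.toComplex` the drawn open edges are the sibling's
`openEdgeUnion δ ω` (`meshPoint δ x = δ · toComplex x`). [folklore] -/
theorem openEdgeUnionEmb_toComplex (δ : ℝ) (ω : BondConfig (Site 2)) :
    openEdgeUnionEmb Site.toComplex δ ω = openEdgeUnion δ ω := rfl

/-- `openEdgeUnionEmb z δ` is monotone in the configuration. [folklore] -/
theorem openEdgeUnionEmb_mono (z : Site 2 → ℂ) (δ : ℝ) {ω ω' : BondConfig (Site 2)} (h : ω ⊆ ω') :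
    openEdgeUnionEmb z δ ω ⊆ openEdgeUnionEmb z δ ω' := by
  intro p hp
  simp only [openEdgeUnionEmb, mem_iUnion, exists_prop] at hp ⊢
  obtain ⟨x, y, hxy, hω, hp⟩ := hp
  exact ⟨x, y, hxy, h hω, hp⟩

/-- The **Schramm–Smirnov crossing event** `𝒞_δ(Q)` of the quad `Q = (closure R.carrier; R.pt 0, …,
R.pt 3)` by the open edges of `ℤ²` drawn along `z` at mesh `δ`: some point of the side `R.arc 0` is
joined to some point of `R.arc 2` by a continuous path inside the closed quad and the drawn open
edges (the sibling's `quadCrossing` is the case `z = Site.toComplex`).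
[cite: DKKMO2020Rotational, §1.2 p. 4 ("a crossing of Q is a continuous path in Q going from (ab) to (cd)")] -/
def quadCrossingEmb (z : Site 2 → ℂ) (R : ConformalRectangle) (δ : ℝ) : Set (BondConfig (Site 2)) :=
  {ω | ∃ a ∈ R.arc 0, ∃ b ∈ R.arc 2, JoinedIn (closure R.carrier ∩ openEdgeUnionEmb z δ ω) a b}

/-- For `z = Site.toComplex` this is the sibling's `quadCrossing R δ`. [folklore] -/
theorem quadCrossingEmb_toComplex (R : ConformalRectangle) (δ : ℝ) :
    quadCrossingEmb Site.toComplex R δ = quadCrossing R δ := rfl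

/-- The quad-crossing event is increasing. [folklore] -/
theorem isUpperSet_quadCrossingEmb (z : Site 2 → ℂ) (R : ConformalRectangle) (δ : ℝ) :
    IsUpperSet (quadCrossingEmb z R δ) := by
  rintro ω ω' h ⟨a, ha, b, hb, hab⟩
  exact ⟨a, ha, b, hb, hab.mono (inter_subset_inter_right _ (openEdgeUnionEmb_mono z δ h))⟩

/-! ### DKKMO, Theorem 2.1 at `q = 1`, read on quad-crossing probabilities -/

/-- **Universality of quad-crossing probabilities among the rectangular lattices `𝕃(α)`, `q = 1`**
(Duminil-Copin–Kozlowski–Krachun–Manolescu–Oulamara, arXiv:2012.11672v1, Theorem 2.1: "For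
`q ∈ [1,4]` and `ε > 0`, there exists `δ₀ = δ₀(q, ε) > 0` such that for every `δ < δ₀` and
`α ∈ (ε, π - ε)`, there exists a coupling `P_{α,δ,ε}` between `ω ∼ φ_{δ𝕃(α)}` and `ω' ∼ φ_{δ𝕃(π/2)}`
such that … `P_{α,δ,ε}[d_SS(ω, ω') > ε] < ε`. This result states the universality of the scaling
limit among rectangular lattices", read on the crossing probability of a quad exactly as the paper
reads Theorem 1.2 in Corollary 1.3, §7.1 p. 43: "the result follows directly from [the theorem] and
the measurability of `𝒞(Q)` in the Schramm–Smirnov topology"). At `q = 1`, `φ_{δ𝕃(α)}` is Bernoulli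
bond percolation on the abstract `ℤ²` with the canonical weights `isoRectCriticalProb α`
(`prodBernoulli`), the lattice drawn as `δ𝕃(α)` = `isoRectDrawing α` rescaled by `δ`. Statement, FOR
EACH QUAD (a `ConformalRectangle` `R`): for every `ε > 0` there is `δ₀ > 0` such that for every
`α ∈ (ε, π - ε)` and every `δ ∈ (0, δ₀)`,
`|P_{𝕃(α)}[𝒞_δ(Q) on δ𝕃(α)] - P_{𝕃(π/2)}[𝒞_δ(Q) on δ𝕃(π/2)]| ≤ ε`
(`quadCrossingEmb (isoRectDrawing ·) R δ`; `δ₀ = δ₀(Q, ε)` — weaker than the printed uniformity,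
cf. the sibling `dkkmo_crossing_rotation_invariance`). Named fact, not proved here; everything
further (discrete-arc events, other positions of the lattices, `P_{𝕃(π/2)} = P_{1/2}` on `ℤ²`,
couplings) is left to consumers (module docstring). [cite: DKKMO2020Rotational, Thm. 2.1 (q = 1), with §7.1 p. 43] -/
def DKKMO2020_thm21_quadCrossingProb : Prop :=
  ∀ (R : ConformalRectangle) (ε : ℝ), 0 < ε →
    ∃ δ₀ : ℝ, 0 < δ₀ ∧ ∀ α ∈ Set.Ioo ε (Real.pi - ε), ∀ δ ∈ Set.Ioo (0 : ℝ) δ₀,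
      |(prodBernoulli (isoRectCriticalProb α)).real (quadCrossingEmb (isoRectDrawing α) R δ) -
          (prodBernoulli (isoRectCriticalProb (Real.pi / 2))).real
            (quadCrossingEmb (isoRectDrawing (Real.pi / 2)) R δ)| ≤ ε

end Literature.Probability.Percolation

end
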